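import Summits.Ventures.PercRepro.ProfilePointedCapPlus

/-!
# PercRepro — THE NAMED FACT A′: THE `p`-AVOIDING PROFILE IS ULTRA-LOG-CONCAVE; CONJECTURE (D) REDUCES TO ITS TOP LEVEL
(p10, gen 26)

For a finite matroid `M` on `N` elements and a point `p`, `out_k = #{X ∈ BI_k : p ∉ X}` is the MIXED profile of the pair
`(M ∖ p, M / p)` on the `n = N − 1` elements of `E ∖ p`: `out_k = #{X ⊆ E ∖ p : #X = k, X ∈ I(M ∖ p), (E ∖ p) ∖ X ∈ I(M / p)}`.
THE NAMED FACT A′ (`AvoidDensityLogConcave`, a `Prop`, NOT asserted here): `out_k / C(n, k)` is log-concave with no internal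
zeros.  Paper proof, from the same published theorems as Theorem A (`BiIndepDensityLogConcave`, ProfileBiIndepDensity):
for ANY two matroids `M₁, M₂` on the same ground set `E′` the polynomials `f_{M₁}(s; x) = Σ_{A ∈ I(M₁)} s^{n−#A} x^A` and
`f_{M₂}(t; x)` are Lorentzian (Brändén–Huh, *Lorentzian polynomials*, Ann. of Math. (2) 192 (2020), the display of
Thm 4.14 via Thm 4.10), their product is Lorentzian (BH Cor. 2.32), `∂_{x_1} ⋯ ∂_{x_n}` of it is Lorentzian (BH Cor. 2.11)
and so is its value at `x = 0` (BH Thm 2.10), and that value is `Σ_{A ⊔ B = E′} s^{n−#A} t^{n−#B} [A ∈ I(M₁)][B ∈ I(M₂)]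
= Σ_k m_k s^{n−k} t^k` with `m_k` the mixed profile; a bivariate Lorentzian polynomial has ultra-log-concave coefficients
with no internal zeros (BH, proof of Thm 4.14).  With `M₁ = M ∖ p`, `M₂ = M / p`: `m_k = out_k` (no quotient relation
is used).  Conjecture (D) `(N − k − 1)·out_k ≤ (k + 1)·out_{k+1}` (gen 25, `AvoidRow`) says that the normalised
`p`-avoiding profile is non-decreasing up to the middle; A′ makes it UNIMODAL, so (D) is about the LOCATION OF THE MODE:

* `outCount_succ_pos_of_pos` (unconditional): `out_k > 0 ⟹ out_{k+1} > 0` for `2k + 2 ≤ N` (every `p`-avoiding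
  bi-independent `k`-set has at least `N − 2k ≥ 2` extensions, one of them not `p`);
* `step_down_nat` (arithmetic): log-concavity carries the step `a_{k+1} ≤ a_{k+2}` down to `a_k ≤ a_{k+1}`;
* **`avoidRowAt_of_top_of_fact'`: modulo A′, (D) at the TOP level `K = (N − 2)/2` of the window gives (D) at EVERY level**
  — conjecture (D) is ONE inequality per pointed matroid; for `N = 2K + 2` it is `κ_K ≤ κ_{K+1}` (the coincidence of
  (H), (D), (A1κ⁺) at the middle, ProfilePointedMirrorLimit), for `N = 2K + 3` it is `(K + 2)·out_K ≤ (K + 1)·out_{K+1}`,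
  which (A1κ⁺) at `K` and Theorem A for `M / p` give (`avoidRowAt_of_capRowPlus_top_of_fact`).

Nothing here asserts A′, Theorem A, (D), (A1κ⁺) or (Ĉ).
-/

open scoped Matroid

namespace PercRepro.Cogirth

open Finset ThmH Skew

variable {α : Type} [DecidableEq α] {M : Matroid α} [M.Finite]

/-! ### The named fact A′ -/

/-- **THE NAMED FACT A′** (a `Prop`; NOT asserted): for every finite matroid `M` on `N` elements and every point `p`
the `p`-avoiding density `out_k / C(N − 1, k)` is log-concave —
`out_{k−1} out_{k+1} C(N−1,k)² ≤ out_k² C(N−1,k−1) C(N−1,k+1)` — with no internal zeros.  Paper proof from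
Brändén–Huh (Lorentzian polynomials, Ann. of Math. 192 (2020); Thm 4.10 / the display of Thm 4.14, Cor. 2.11, Cor. 2.32,
Thm 2.10), exactly as for Theorem A with the two factors `f_{M ∖ p}(s; x)·f_{M / p}(t; x)` in place of `f_M(s; x)·f_M(t; x)`
(module docstring). -/
def AvoidDensityLogConcave (α : Type) [DecidableEq α] : Prop :=
  ∀ (M : Matroid α) [M.Finite] (p : α), p ∈ gr M →
    (∀ k : ℕ, 1 ≤ k → k + 1 ≤ (gr M).card - 1 →
      outCount M (k - 1) p * outCount M (k + 1) p *
          (((gr M).card - 1).choose k * ((gr M).card - 1).choose k) ≤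
        outCount M k p * outCount M k p *
          (((gr M).card - 1).choose (k - 1) * ((gr M).card - 1).choose (k + 1))) ∧
    (∀ i k j : ℕ, i < k → k < j → j ≤ (gr M).card - 1 →
      0 < outCount M i p → 0 < outCount M j p → 0 < outCount M k p)

/-! ### Positivity propagates upward, unconditionally -/

/-- A `p`-avoiding bi-independent `k`-set with `2k + 2 ≤ N` extends to a `p`-avoiding bi-independent `(k+1)`-set: it
has at least `N − 2k ≥ 2` extending elements (`card_ext_ge`), one of which is not `p`. -/
theorem outCount_succ_pos_of_pos {p : α} {k : ℕ} (hk : 2 * k + 2 ≤ (gr M).card)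
    (h : 0 < outCount M k p) : 0 < outCount M (k + 1) p := by
  unfold outCount at h ⊢
  rw [card_pos] at h ⊢
  obtain ⟨X, hX⟩ := h
  rw [mem_filter] at hX
  obtain ⟨hXb, hpX⟩ := hX
  have h2 := card_ext_ge (M := M) hXb
  set S := (gr M).filter (fun q => q ∉ X ∧ insert q X ∈ biIndepSets M (k + 1)) with hS
  obtain ⟨q, hqS, hqp⟩ : ∃ q ∈ S, q ≠ p := by
    by_contra hcon
    have hsub : S ⊆ {p} := fun q hq => mem_singleton.2 (by
      by_contra hne
      exact hcon ⟨q, hq, hne⟩)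
    have := card_le_card hsub
    rw [card_singleton] at this
    omega
  rw [hS, mem_filter] at hqS
  refine ⟨insert q X, mem_filter.2 ⟨hqS.2.2, ?_⟩⟩
  rw [mem_insert, not_or]
  exact ⟨fun h => hqp h.symm, hpX⟩

/-! ### The arithmetic of the descent -/

/-- **Log-concavity carries the step down one level**: with `a0, a1, a2` the binomials `C(n,k), C(n,k+1), C(n,k+2)`
(`a1·(k+1) = a0·(n−k)`, `a2·(k+2) = a1·(n−k−1)`), the log-concavity `A·C·a1² ≤ B²·a0·a2` of `(A, B, C) =
(out_k, out_{k+1}, out_{k+2})`, the step `(n−k−1)·B ≤ (k+2)·C` at level `k + 1` and `A > 0 ⟹ B > 0` give the step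
`(n−k)·A ≤ (k+1)·B` at level `k`. -/
theorem step_down_nat {n k A B C a0 a1 a2 : ℕ} (hkn : k + 2 ≤ n) (ha0 : 0 < a0) (ha1 : 0 < a1)
    (h1 : a1 * (k + 1) = a0 * (n - k)) (h2 : a2 * (k + 2) = a1 * (n - k - 1))
    (hlc : A * C * (a1 * a1) ≤ B * B * (a0 * a2)) (hD1 : (n - k - 1) * B ≤ (k + 2) * C)
    (hpos : 0 < A → 0 < B) : (n - k) * A ≤ (k + 1) * B := by
  rcases Nat.eq_zero_or_pos C with hC | hC
  · subst hC
    have hB : B = 0 := by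
      rcases Nat.eq_zero_or_pos B with hB | hB
      · exact hB
      · exfalso
        have : 0 < (n - k - 1) * B := Nat.mul_pos (by omega) hB
        omega
    have hA : A = 0 := by
      rcases Nat.eq_zero_or_pos A with hA | hA
      · exact hA
      · have := hpos hA
        omega
    rw [hA, hB, mul_zero, mul_zero]
  · have key : (a0 * a1) * (A * C * ((k + 2) * (n - k))) ≤ (a0 * a1) * (B * B * ((k + 1) * (n - k - 1))) := by
      calc (a0 * a1) * (A * C * ((k + 2) * (n - k)))
          = A * C * (a1 * (k + 2)) * (a0 * (n - k)) := by ring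
        _ = A * C * (a1 * (k + 2)) * (a1 * (k + 1)) := by rw [h1]
        _ = (A * C * (a1 * a1)) * ((k + 1) * (k + 2)) := by ring
        _ ≤ (B * B * (a0 * a2)) * ((k + 1) * (k + 2)) := Nat.mul_le_mul_right _ hlc
        _ = B * B * (a0 * (k + 1)) * (a2 * (k + 2)) := by ring
        _ = B * B * (a0 * (k + 1)) * (a1 * (n - k - 1)) := by rw [h2]
        _ = (a0 * a1) * (B * B * ((k + 1) * (n - k - 1))) := by ring
    have key2 := Nat.le_of_mul_le_mul_left key (Nat.mul_pos ha0 ha1)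
    have key3 : A * C * ((k + 2) * (n - k)) ≤ B * (k + 1) * ((k + 2) * C) := by
      calc A * C * ((k + 2) * (n - k)) ≤ B * B * ((k + 1) * (n - k - 1)) := key2
        _ = B * (k + 1) * ((n - k - 1) * B) := by ring
        _ ≤ B * (k + 1) * ((k + 2) * C) := Nat.mul_le_mul_left _ hD1
    have key4 : ((k + 2) * C) * ((n - k) * A) ≤ ((k + 2) * C) * ((k + 1) * B) := by
      calc ((k + 2) * C) * ((n - k) * A) = A * C * ((k + 2) * (n - k)) := by ring
        _ ≤ B * (k + 1) * ((k + 2) * C) := key3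
        _ = ((k + 2) * C) * ((k + 1) * B) := by ring
    exact Nat.le_of_mul_le_mul_left key4 (Nat.mul_pos (by omega) hC)

/-! ### (D) descends from the top level -/

/-- **(D) AT LEVEL `k + 1` GIVES (D) AT LEVEL `k`** (`2k + 4 ≤ N`), modulo A′. -/
theorem avoidRow_level_of_succ_of_fact' (hfact' : AvoidDensityLogConcave α) {p : α} (hp : p ∈ gr M) {k : ℕ}
    (hk : 2 * k + 4 ≤ (gr M).card)
    (hD1 : ((gr M).card - (k + 1) - 1) * outCount M (k + 1) p ≤ (k + 1 + 1) * outCount M (k + 1 + 1) p) :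
    ((gr M).card - k - 1) * outCount M k p ≤ (k + 1) * outCount M (k + 1) p := by
  obtain ⟨hlc, -⟩ := hfact' M p hp
  have h := hlc (k + 1) (by omega) (by omega)
  rw [show k + 1 - 1 = k by omega] at h
  have h1 := Nat.choose_succ_right_eq ((gr M).card - 1) k
  have h2 := Nat.choose_succ_right_eq ((gr M).card - 1) (k + 1)
  have hD1' : ((gr M).card - 1 - k - 1) * outCount M (k + 1) p ≤ (k + 2) * outCount M (k + 2) p := by
    rw [show (gr M).card - 1 - k - 1 = (gr M).card - (k + 1) - 1 by omega]
    exact hD1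
  have hres := step_down_nat (n := (gr M).card - 1) (k := k) (A := outCount M k p) (B := outCount M (k + 1) p)
    (C := outCount M (k + 2) p) (a0 := ((gr M).card - 1).choose k) (a1 := ((gr M).card - 1).choose (k + 1))
    (a2 := ((gr M).card - 1).choose (k + 2)) (by omega) (Nat.choose_pos (by omega)) (Nat.choose_pos (by omega))
    h1 (by rw [h2, show (gr M).card - 1 - (k + 1) = (gr M).card - 1 - k - 1 by omega]) h hD1'
    (outCount_succ_pos_of_pos (by omega))
  rwa [show (gr M).card - 1 - k = (gr M).card - k - 1 by omega] at hres

/-- **CONJECTURE (D) IS ONE INEQUALITY PER POINTED MATROID, MODULO A′**: (D) at the top level `K = (N − 2)/2` of the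
window `2k + 2 ≤ N` gives (D) at every level. -/
theorem avoidRowAt_of_top_of_fact' (hfact' : AvoidDensityLogConcave α) {p : α} (hp : p ∈ gr M)
    (htop : ((gr M).card - ((gr M).card - 2) / 2 - 1) * outCount M (((gr M).card - 2) / 2) p ≤
      (((gr M).card - 2) / 2 + 1) * outCount M (((gr M).card - 2) / 2 + 1) p) :
    AvoidRowAt M p := by
  set K := ((gr M).card - 2) / 2 with hK
  suffices h : ∀ d k, k + d = K → ((gr M).card - k - 1) * outCount M k p ≤ (k + 1) * outCount M (k + 1) p by
    intro k hk
    exact h (K - k) k (by omega)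
  intro d
  induction d with
  | zero =>
    intro k hk
    rw [show k = K by omega]
    exact htop
  | succ d ih =>
    intro k hk
    have hD1 := ih (k + 1) (by omega)
    exact avoidRow_level_of_succ_of_fact' hfact' hp (by omega) hD1

/-- For an EVEN ground set `N = 2K + 2`, (D) at every level follows (mod A′) from the single middle inequality
`κ_K ≤ κ_{K+1}` — which is also (H) and (A1κ⁺) at that level (ProfilePointedMirrorLimit). -/
theorem avoidRowAt_of_capCount_le_of_fact' (hfact' : AvoidDensityLogConcave α) {p : α} (hp : p ∈ gr M)
    {K : ℕ} (hN : (gr M).card = 2 * K + 2) (hmid : capCount M K p ≤ capCount M (K + 1) p) :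
    AvoidRowAt M p := by
  apply avoidRowAt_of_top_of_fact' hfact' hp
  rw [show ((gr M).card - 2) / 2 = K by omega, ← capCount_add_extCount K hp, ← capCount_add_extCount (K + 1) hp,
    show (gr M).card - K - 1 = K + 1 by omega]
  have hc : extCount M K p = extCount M (K + 1) p := by
    have := extCount_symm hp K (by omega)
    rwa [show (gr M).card - 1 - K = K + 1 by omega] at this
  rw [hc]
  exact Nat.mul_le_mul_left _ (by omega)

/-- (A1κ⁺) at the top level of the window and Theorem A for `M / p` give (D) at the top level, hence (mod A′) at every
level — for every parity of `N`. -/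
theorem avoidRowAt_of_capRowPlus_top_of_fact (hfact : BiIndepDensityLogConcave α) (hfact' : AvoidDensityLogConcave α)
    {p : α} (hp : p ∈ gr M) (hN : 2 ≤ (gr M).card)
    (hcap : ((gr M).card - ((gr M).card - 2) / 2 - 1) * capCount M (((gr M).card - 2) / 2) p ≤
      (((gr M).card - 2) / 2 + 1) * capCount M (((gr M).card - 2) / 2 + 1) p) :
    AvoidRowAt M p :=
  avoidRowAt_of_top_of_fact' hfact' hp (avoidRow_level_of_capRowPlus_of_fact hfact hp (by omega) hcap)

end PercRepro.Cogirth
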